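import Literature.IUT.HodgeTheaters.Processions
import Literature.IUT.HodgeTheaters.PolyIsoFunctoriality
import HarnessLib

/-!
# [IUTchI] Proposition 4.11 and Corollary 4.12 — proof-only companion of `Processions.lean`

Mochizuki, *Inter-universal Teichmüller theory I*, §4, kurims manuscript (May 2020), Proposition 4.11 (i)(ii)
pp. 120–121 and Corollary 4.12 (i)–(iii) pp. 121–122 [claim: Mochizuki2012, status: disputed]. abc-iut cell,
DISCHARGE WAVE 4 (D-0067): DAG nodes `IUTchI:Prop4.11(i)`, `IUTchI:Prop4.11(ii)`, `IUTchI:Cor4.12(i)`,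
`IUTchI:Cor4.12(ii)`, `IUTchI:Cor4.12(iii)` (layer L5; typer file `Processions.lean`, abc-iut-L5-t3, untouched).
THEOREMS ONLY over the hypothesis structure `BaseThetaDatum`; inputs consumed BY NAME (`DThetaBridge.χ`, `χ_comp`,
`Hom.subsingleton`, `SStar`, `ncard_sStar`, `sStar_lStar`, `prod_procession_possibilities`, `card_labelings`,
`factorial_lStar_lt_pow`, `dThetaNFLink_nonempty`, `BaseThetaDatum.monoIso_refl/trans`, `PolyIso.symm_full`).

Kernel-checked here, beyond the typer's in-file theorems (print: "(i), (ii) follow immediately from the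
definitions"; Cor. 4.12 "is an immediate consequence of our discussion" — so every proof is short):
* Prop. 4.11 (i) "determines a natural FUNCTOR [on] the category of `𝒟`-Θ-bridges and isomorphisms": that
  category is a codiscrete groupoid (Prop. 4.8 (ii)) with index-set laws `DThetaBridge.Hom.ι_endo/ι_comp/ι_inv`;
  `Prc` respects identities and composites (`Hom.prc_emb_endo`, `Hom.prc_emb_comp`) and sends isomorphisms to
  capsule-full poly-ISOmorphisms (`Hom.prc_emb_bijective`); the arrows of `Prc(†𝒟_J)` are the sub-capsule
  inclusions (`exists_prcIdx_embedding`; strict, `sStar_ssubset_succ`); first capsule = the strip of label `1`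
  (`sStar_one`, `mem_prcIdx_first_iff`), last capsule = all of `†𝒟_J` (`prcIdx_last_val_bijective`).
* Prop. 4.11 (i), the count AS PRINTED — "by taking the product, over elements of `F_l^⋇`, of cardinalities of
  'sets of possibilities' … the indeterminacy consisting of `(l^⋇)^{l^⋇}` possibilities … is reduced to … a total
  of `l^⋇!` possibilities" — for EVERY `𝒟`-Θ-bridge: `∏_n |idx of the n-capsule| = l^⋇! = |𝔖(J)| < |J → F_l^⋇|`
  (`prod_card_prcIdx`, `prod_card_prcIdx_eq_card_perm`, `prod_card_prcIdx_lt_card_labelings`; label form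
  `prod_ncard_sStar`; pre-composed with `†ℋ𝒯^{𝒟-ΘNF} ↦ †φ^Θ_⋆`: `DThetaNFHodgeTheater.prod_card_prcIdx(_lt)`).
* Prop. 4.11 (ii) "the same indeterminacy properties": same index sets / counts / induced morphisms for
  `Prc(†𝒟^⊢_J)` (`prcMono_idx`, `card_prcMono_idx`, `prod_card_prcMono_idx`, `Hom.exists_prcMono_hom`);
  mono-analyticisation is functorial on `𝒟`-prime-strips (`DPrimeStrip.monoIso_refl/trans/symm`).
* Cor. 4.12 (i): induced isomorphisms of codomains mono-analyticise INTO the `𝒟`-ΘNF-link, which is symmetric and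
  composable (`monoIso_mem_dThetaNFLink`, `dThetaNFLink_symm/comp`, via L6-t3's `PolyIsoFunctoriality`).
* Cor. 4.12 (ii) "constant invariant … mono-analytic core": composites of links along the chain are THE link
  between the ends, path-independently; attaching a spoke through a link = attaching directly
  (`DThetaNFChain.link_comp_link/link_comp_dThetaNFLink/link_symm/link_comp_attach`).
* Cor. 4.12 (iii) "arbitrary permutation symmetries among the spokes": a transitive `𝔖(ℤ)`-action
  (`DEtalePicture.perm_one/perm_mul/exists_perm_spoke_eq`); the chain's shift `n ↦ n+1` is one of them
  (`DThetaNFChain.etalePicture_perm_addRight`).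
Record-only; typed ≠ endorsed; nothing here takes a side on [IUTchIII] Cor. 3.12 or asserts anything about abc.
-/

namespace Literature.IUT.HodgeTheaters

open CategoryTheory

open scoped Nat

universe v u

/-! ### The label sets `S^⋇_j = {1, …, j} ⊆ F_l^⋇` of Prop. 4.11 (i): first set, strictness, the product count -/

section PosLabels

variable (l : ℕ) [Fact l.Prime]

/-- The label `1 ∈ F_l^⋇` is represented by the positive integer `1` (Prop. 4.11 (i): "we use the notation for
positive integers to denote the images of these positive integers in `F_l^⋇`"). [claim: Mochizuki2012, status: disputed] -/
theorem FlStar.absVal_one : FlStar.absVal l 1 = 1 := by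
  have h2 : 1 ≤ l / 2 := (Nat.le_div_iff_mul_le two_pos).2 (by simpa using (Fact.out : l.Prime).two_le)
  change ((1 : (ZMod l)ˣ) : ZMod l).valMinAbs.natAbs = 1
  rw [Units.val_one, ← Nat.cast_one, ZMod.valMinAbs_natCast_of_le_half h2, Int.natAbs_natCast]

/-- `S^⋇_1 = {1}`: the `1`-capsule "/⋇" of Fig. 4.6 is indexed by the single label `1`
(Prop. 4.11 (i): `S^⋇_j := {1, 2, …, j}`). [claim: Mochizuki2012, status: disputed] -/
theorem sStar_one (hl : l ≠ 2) : SStar l 1 = {1} := by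
  ext x
  simp only [SStar, Set.mem_setOf_eq, Set.mem_singleton_iff]
  constructor
  · intro hx
    apply FlStar.absVal_injective l
    rw [FlStar.absVal_one]
    exact le_antisymm hx (FlStar.absVal_mem_Icc l hl x).1
  · rintro rfl
    rw [FlStar.absVal_one]

/-- The inclusions `S^⋇_j ⊆ S^⋇_{j+1}` (`j < l^⋇`) of Prop. 4.11 (i) are STRICT — the procession
`P_1 ↪ P_2 ↪ … ↪ P_{l^⋇}` grows by one strip at each step. [claim: Mochizuki2012, status: disputed] -/
theorem sStar_ssubset_succ (hl : l ≠ 2) {j : ℕ} (hj : j < lStar l) : SStar l j ⊂ SStar l (j + 1) := by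
  refine Set.ssubset_iff_subset_ne.2 ⟨sStar_mono l (Nat.le_succ j), fun h => ?_⟩
  have h' := congrArg Set.ncard h
  rw [ncard_sStar l hl hj.le, ncard_sStar l hl hj] at h'
  omega

/-- **Prop. 4.11 (i), the count in label form**: "by taking the product, over elements of `F_l^⋇` [the
`n ∈ {1, …, l^⋇}`], of cardinalities of 'sets of possibilities' [the `n` labels `S^⋇_n` available to an index of
the `n`-capsule], one concludes … a total of `l^⋇!` possibilities": `∏_{n=1}^{l^⋇} |S^⋇_n| = l^⋇!` over the REAL
label sets (joins `ncard_sStar` with `prod_procession_possibilities`). [claim: Mochizuki2012, status: disputed] -/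
theorem prod_ncard_sStar (hl : l ≠ 2) :
    ∏ j ∈ Finset.range (lStar l), (SStar l (j + 1)).ncard = (lStar l)! := by
  rw [← prod_procession_possibilities (lStar l)]
  exact Finset.prod_congr rfl fun j hj => ncard_sStar l hl (Finset.mem_range.1 hj)

end PosLabels

namespace BaseThetaDatum

variable {𝔡 : BaseThetaDatum.{u}}

/-! ### The category of `𝒟`-Θ-bridges and isomorphisms (source of the functor of Prop. 4.11 (i)) -/

/-- Identity law of the (codiscrete, Prop. 4.8 (ii)) groupoid of `𝒟`-Θ-bridges: an isomorphism `†φ^Θ_⋆ ⥲ †φ^Θ_⋆`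
induces the identity of `J` (labels are preserved and `†χ` is a bijection). [claim: Mochizuki2012, status: disputed] -/
theorem DThetaBridge.Hom.ι_endo {B : 𝔡.DThetaBridge} (f : DThetaBridge.Hom 𝔡 B B) :
    f.ι = Equiv.refl B.J := by
  ext j
  exact B.χ.injective (by rw [f.χ_comp]; rfl)

/-- Composition law: for isomorphisms `f : B ⥲ B'`, `g : B' ⥲ B''` and (the) isomorphism `k : B ⥲ B''`, the
index bijections compose: `k = g ∘ f` on `J`. [claim: Mochizuki2012, status: disputed] -/
theorem DThetaBridge.Hom.ι_comp {B B' B'' : 𝔡.DThetaBridge} (f : DThetaBridge.Hom 𝔡 B B')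
    (g : DThetaBridge.Hom 𝔡 B' B'') (k : DThetaBridge.Hom 𝔡 B B'') : k.ι = f.ι.trans g.ι := by
  ext j
  apply B''.χ.injective
  rw [k.χ_comp, Equiv.trans_apply, g.χ_comp, f.χ_comp]

/-- Inverse law: for `f : B ⥲ B'`, `g : B' ⥲ B` the index bijections are inverse. [claim: Mochizuki2012, status: disputed] -/
theorem DThetaBridge.Hom.ι_inv {B B' : 𝔡.DThetaBridge} (f : DThetaBridge.Hom 𝔡 B B')
    (g : DThetaBridge.Hom 𝔡 B' B) : g.ι = f.ι.symm := by
  ext j'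
  apply B.χ.injective
  rw [g.χ_comp, ← f.χ_comp (f.ι.symm j'), Equiv.apply_symm_apply]

/-! ### Proposition 4.11 (i): `Prc` is a functor; its arrows; its first and last capsules -/

/-- On the index set of the `(n+1)`-capsule, `Prc(f)` restricts the bijection `ι` of `f` (and lies over the identity
of `{1, …, l^⋇}`). [claim: Mochizuki2012, status: disputed] -/
theorem DThetaBridge.Hom.prc_emb_val {B B' : 𝔡.DThetaBridge} (f : DThetaBridge.Hom 𝔡 B B')
    (n : Fin (lStar 𝔡.l)) (i : B.prcIdx n) : (f.prc.emb n i : B'.prcIdx n).1 = f.ι i.1 :=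
  rfl

/-- **Functor law (identities)** for `†φ^Θ_⋆ ↦ Prc(†𝒟_J)`: an isomorphism `†φ^Θ_⋆ ⥲ †φ^Θ_⋆` induces the identity
morphism of the procession `Prc(†𝒟_J)` (identity on every index set). [claim: Mochizuki2012, status: disputed] -/
theorem DThetaBridge.Hom.prc_emb_endo {B : 𝔡.DThetaBridge} (f : DThetaBridge.Hom 𝔡 B B)
    (n : Fin (lStar 𝔡.l)) (i : B.prcIdx n) : (f.prc.emb n i : B.prcIdx n) = i := by
  apply Subtype.ext
  rw [DThetaBridge.Hom.prc_emb_val, DThetaBridge.Hom.ι_endo]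
  rfl

/-- **Functor law (composites)** for `†φ^Θ_⋆ ↦ Prc(†𝒟_J)`: `Prc(g ∘ f) = Prc(g) ∘ Prc(f)` on every index set, for
isomorphisms `f : B ⥲ B'`, `g : B' ⥲ B''` and the isomorphism `k : B ⥲ B''`. [claim: Mochizuki2012, status: disputed] -/
theorem DThetaBridge.Hom.prc_emb_comp {B B' B'' : 𝔡.DThetaBridge} (f : DThetaBridge.Hom 𝔡 B B')
    (g : DThetaBridge.Hom 𝔡 B' B'') (k : DThetaBridge.Hom 𝔡 B B'') (n : Fin (lStar 𝔡.l)) (i : B.prcIdx n) :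
    (k.prc.emb n i : B''.prcIdx n) = g.prc.emb n (f.prc.emb n i : B'.prcIdx n) := by
  apply Subtype.ext
  rw [DThetaBridge.Hom.prc_emb_val, DThetaBridge.Hom.prc_emb_val, DThetaBridge.Hom.prc_emb_val,
    DThetaBridge.Hom.ι_comp f g k, Equiv.trans_apply]

/-- `Prc` sends isomorphisms of `𝒟`-Θ-bridges to capsule-full poly-ISOmorphisms: on each capsule the induced
injection of index sets is a bijection (labels are preserved, so `ι` maps the indices of label `∈ S^⋇_{n+1}`
ONTO the indices of label `∈ S^⋇_{n+1}`). [claim: Mochizuki2012, status: disputed] -/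
theorem DThetaBridge.Hom.prc_emb_bijective {B B' : 𝔡.DThetaBridge} (f : DThetaBridge.Hom 𝔡 B B')
    (n : Fin (lStar 𝔡.l)) : Function.Bijective (f.prc.emb n) := by
  refine ⟨(f.prc.emb n).injective, fun i' => ?_⟩
  obtain ⟨i', hi'⟩ := i'
  have hi : B.χ (f.ι.symm i') ∈ SStar 𝔡.l ((n : ℕ) + 1) := by
    rw [← f.χ_comp, Equiv.apply_symm_apply]
    exact hi'
  exact ⟨⟨f.ι.symm i', hi⟩, Subtype.ext (f.ι.apply_symm_apply i')⟩

/-- The arrows `P_{n+1} ↪ P_{m+1}` (`n ≤ m`) of `Prc(†𝒟_J)`: an index of the `(n+1)`-capsule (label `∈ S^⋇_{n+1}`)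
is an index of the `(m+1)`-capsule (label `∈ S^⋇_{m+1} ⊇ S^⋇_{n+1}`). [claim: Mochizuki2012, status: disputed] -/
theorem DThetaBridge.prcIdx_mono (B : 𝔡.DThetaBridge) {n m : Fin (lStar 𝔡.l)} (h : n ≤ m)
    (i : B.prcIdx n) : B.χ i.1 ∈ SStar 𝔡.l ((m : ℕ) + 1) :=
  sStar_mono 𝔡.l (Nat.succ_le_succ h) i.2

/-- … so the sub-capsule inclusion `P_{n+1} ↪ P_{m+1}` lies over an INJECTION of index sets compatible with the
constituents (a member of the capsule-full poly-morphism of Def. 4.10). [claim: Mochizuki2012, status: disputed] -/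
theorem DThetaBridge.exists_prcIdx_embedding (B : 𝔡.DThetaBridge) {n m : Fin (lStar 𝔡.l)} (h : n ≤ m) :
    ∃ e : B.prcIdx n ↪ B.prcIdx m, ∀ i, (e i).1 = i.1 ∧ B.prc.obj m (e i) = B.prc.obj n i :=
  ⟨⟨fun i => ⟨i.1, B.prcIdx_mono h i⟩, fun i j hij => Subtype.ext (by simpa using congrArg Subtype.val hij)⟩,
    fun _ => ⟨rfl, rfl⟩⟩

/-- The FIRST capsule "/⋇" of `Prc(†𝒟_J)` (Fig. 4.6) consists of exactly the index of label `1`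
(`S^⋇_1 = {1}`). [claim: Mochizuki2012, status: disputed] -/
theorem DThetaBridge.mem_prcIdx_first_iff (B : 𝔡.DThetaBridge) {n : Fin (lStar 𝔡.l)} (hn : (n : ℕ) = 0)
    (i : B.J) : B.χ i ∈ SStar 𝔡.l ((n : ℕ) + 1) ↔ B.χ i = 1 := by
  rw [hn, zero_add, sStar_one 𝔡.l 𝔡.l_ne_two, Set.mem_singleton_iff]

/-- The LAST capsule of `Prc(†𝒟_J)` is the whole capsule `†𝒟_J` (`S^⋇_{l^⋇} = F_l^⋇`): its index set maps
bijectively onto `J`. [claim: Mochizuki2012, status: disputed] -/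
theorem DThetaBridge.prcIdx_last_val_bijective (B : 𝔡.DThetaBridge) {n : Fin (lStar 𝔡.l)}
    (hn : (n : ℕ) + 1 = lStar 𝔡.l) : Function.Bijective (Subtype.val : B.prcIdx n → B.J) := by
  refine ⟨Subtype.val_injective, fun i => ⟨⟨i, ?_⟩, rfl⟩⟩
  rw [hn, sStar_lStar 𝔡.l 𝔡.l_ne_two]
  exact Set.mem_univ _

/-! ### Proposition 4.11 (i): the indeterminacy count `(l^⋇)^{l^⋇} ⇝ l^⋇!` for every `𝒟`-Θ-bridge -/

/-- The index set `J` of a `𝒟`-Θ-bridge has `l^⋇` elements (via `†χ`). [claim: Mochizuki2012, status: disputed] -/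
theorem DThetaBridge.card_J (B : 𝔡.DThetaBridge) : Nat.card B.J = lStar 𝔡.l :=
  (Nat.card_congr B.χ).trans (card_flStar 𝔡.l 𝔡.l_ne_two)

/-- **Prop. 4.11 (i), the count, for the procession `Prc(†𝒟_J)` of a `𝒟`-Θ-bridge**: "by taking the product …
of cardinalities of 'sets of possibilities'" — the product over the capsules of `Prc(†𝒟_J)` of the cardinalities
of their index sets is `l^⋇!`. [claim: Mochizuki2012, status: disputed] -/
theorem DThetaBridge.prod_card_prcIdx (B : 𝔡.DThetaBridge) :
    ∏ n : Fin (lStar 𝔡.l), Nat.card (B.prcIdx n) = (lStar 𝔡.l)! := by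
  simp only [DThetaBridge.card_prcIdx]
  exact (Fin.prod_univ_eq_prod_range (fun i => i + 1) (lStar 𝔡.l)).trans
    (prod_procession_possibilities (lStar 𝔡.l))

/-- … which is exactly one `𝔖(J)`-worth of indeterminacy (`|𝔖(J)| = l^⋇!`, Prop. 4.9 (ii): "well-defined only
up to … automorphisms of the set `J`"). [claim: Mochizuki2012, status: disputed] -/
theorem DThetaBridge.prod_card_prcIdx_eq_card_perm (B : 𝔡.DThetaBridge) :
    ∏ n : Fin (lStar 𝔡.l), Nat.card (B.prcIdx n) = Nat.card (Equiv.Perm B.J) := by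
  classical
  haveI := B.finite_J
  haveI := Fintype.ofFinite B.J
  rw [B.prod_card_prcIdx, Nat.card_eq_fintype_card (α := Equiv.Perm B.J), Fintype.card_perm,
    ← Nat.card_eq_fintype_card, B.card_J]

/-- **Prop. 4.11 (i), the reduction, for every `𝒟`-Θ-bridge**: "the indeterminacy consisting of `(l^⋇)^{l^⋇}`
possibilities that arises in Proposition 4.9, (ii) [labellings `J → F_l^⋇`, `card_labelings`], is reduced to an
indeterminacy consisting of a total of `l^⋇!` possibilities": `∏_n |idx_n| < |J → F_l^⋇|`. [claim: Mochizuki2012, status: disputed] -/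
theorem DThetaBridge.prod_card_prcIdx_lt_card_labelings (B : 𝔡.DThetaBridge) :
    ∏ n : Fin (lStar 𝔡.l), Nat.card (B.prcIdx n) < Nat.card (B.J → FlStar 𝔡.l) := by
  haveI := B.finite_J
  rw [B.prod_card_prcIdx, card_labelings 𝔡.l 𝔡.l_ne_two B.J B.card_J]
  exact factorial_lStar_lt_pow 𝔡.l 𝔡.five_le_l

/-- Prop. 4.11 (i), "possibly pre-composed with the functor `†ℋ𝒯^{𝒟-ΘNF} ↦ †φ^Θ_⋆`": the count for the
procession of a `𝒟`-ΘNF-Hodge theater. [claim: Mochizuki2012, status: disputed] -/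
theorem DThetaNFHodgeTheater.prod_card_prcIdx (H : 𝔡.DThetaNFHodgeTheater) :
    ∏ n : Fin (lStar 𝔡.l), Nat.card (H.toDThetaBridge.prcIdx n) = (lStar 𝔡.l)! :=
  H.toDThetaBridge.prod_card_prcIdx

/-- … and the reduction `(l^⋇)^{l^⋇} ⇝ l^⋇!` for a `𝒟`-ΘNF-Hodge theater. [claim: Mochizuki2012, status: disputed] -/
theorem DThetaNFHodgeTheater.prod_card_prcIdx_lt (H : 𝔡.DThetaNFHodgeTheater) :
    ∏ n : Fin (lStar 𝔡.l), Nat.card (H.toDThetaBridge.prcIdx n) < Nat.card (H.J → FlStar 𝔡.l) :=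
  H.toDThetaBridge.prod_card_prcIdx_lt_card_labelings

/-- The composite `†ℋ𝒯^{𝒟-ΘNF} ↦ †φ^Θ_⋆ ↦ Prc(†𝒟_J)` on isomorphisms: a morphism of processions acting on index sets
by the common index bijection of Def. 4.6 (iii). [claim: Mochizuki2012, status: disputed] -/
theorem DThetaNFHodgeTheater.Hom.exists_prc_hom {H H' : 𝔡.DThetaNFHodgeTheater}
    (h : DThetaNFHodgeTheater.Hom H H') :
    ∃ f : Procession.Hom H.toDThetaBridge.prc H'.toDThetaBridge.prc,
      (∀ n, f.ι n = n) ∧ ∀ n (i : H.toDThetaBridge.prcIdx n), (f.emb n i).1 = h.nf.ι i.1 :=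
  ⟨h.theta.prc, fun _ => rfl, fun _ _ => by rw [h.compat]; rfl⟩

/-! ### Proposition 4.11 (ii): mono-analytic processions have the same indeterminacy data -/

/-- Mono-analyticisation of `𝒟`-prime-strips is functorial: identities. [claim: Mochizuki2012, status: disputed] -/
theorem DPrimeStrip.monoIso_refl (X : 𝔡.DPrimeStrip) :
    DPrimeStrip.monoIso (Iso.refl X) = Iso.refl X.mono := by
  apply Iso.ext
  funext v
  change (𝔡.monoIso (Pi.isoApp (Iso.refl X) v)).hom = 𝟙 (X.mono v)
  rw [Pi.isoApp_refl, 𝔡.monoIso_refl]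
  rfl

/-- Mono-analyticisation of `𝒟`-prime-strips is functorial: composites. [claim: Mochizuki2012, status: disputed] -/
theorem DPrimeStrip.monoIso_trans {X Y Z : 𝔡.DPrimeStrip} (f : X ≅ Y) (g : Y ≅ Z) :
    DPrimeStrip.monoIso (f ≪≫ g) = DPrimeStrip.monoIso f ≪≫ DPrimeStrip.monoIso g := by
  apply Iso.ext
  funext v
  change (𝔡.monoIso (Pi.isoApp (f ≪≫ g) v)).hom =
    (𝔡.monoIso (Pi.isoApp f v)).hom ≫ (𝔡.monoIso (Pi.isoApp g v)).hom
  rw [Pi.isoApp_trans, 𝔡.monoIso_trans]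
  rfl

/-- Mono-analyticisation of `𝒟`-prime-strips is functorial: inverses. [claim: Mochizuki2012, status: disputed] -/
theorem DPrimeStrip.monoIso_symm {X Y : 𝔡.DPrimeStrip} (f : X ≅ Y) :
    DPrimeStrip.monoIso f.symm = (DPrimeStrip.monoIso f).symm := by
  have h : DPrimeStrip.monoIso f.symm ≪≫ DPrimeStrip.monoIso f = Iso.refl _ := by
    rw [← DPrimeStrip.monoIso_trans, Iso.symm_self_id, DPrimeStrip.monoIso_refl]
  exact Iso.ext ((Iso.comp_hom_eq_id (DPrimeStrip.monoIso f)).1 (congrArg Iso.hom h))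

/-- **Prop. 4.11 (ii)**: `Prc(†𝒟^⊢_J)` has the SAME index sets as `Prc(†𝒟_J)`. [claim: Mochizuki2012, status: disputed] -/
theorem DThetaBridge.prcMono_idx (B : 𝔡.DThetaBridge) : B.prcMono.idx = B.prcIdx := rfl

/-- Prop. 4.11 (ii): "precisely `n` possibilities" for the `n`-capsule of `Prc(†𝒟^⊢_J)`. [claim: Mochizuki2012, status: disputed] -/
theorem DThetaBridge.card_prcMono_idx (B : 𝔡.DThetaBridge) (n : Fin (lStar 𝔡.l)) :
    Nat.card (B.prcMono.idx n) = (n : ℕ) + 1 :=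
  B.card_prcIdx n

/-- Prop. 4.11 (ii): the same total count `l^⋇!` for `Prc(†𝒟^⊢_J)`. [claim: Mochizuki2012, status: disputed] -/
theorem DThetaBridge.prod_card_prcMono_idx (B : 𝔡.DThetaBridge) :
    ∏ n : Fin (lStar 𝔡.l), Nat.card (B.prcMono.idx n) = (lStar 𝔡.l)! :=
  B.prod_card_prcIdx

/-- Prop. 4.11 (ii), "composing the functor of (i) with the mono-analyticization operation": `f` induces a morphism
`Prc(†𝒟^⊢_J) → Prc(‡𝒟^⊢_{J'})` with the same index maps as `Prc(f)`. [claim: Mochizuki2012, status: disputed] -/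
theorem DThetaBridge.Hom.exists_prcMono_hom {B B' : 𝔡.DThetaBridge} (f : DThetaBridge.Hom 𝔡 B B') :
    ∃ F : Procession.Hom B.prcMono B'.prcMono,
      (∀ n, F.ι n = n) ∧ ∀ n (i : B.prcIdx n), (F.emb n i).1 = f.ι i.1 :=
  ⟨⟨f.prc.ι, f.prc.emb⟩, fun _ => rfl, fun _ _ => rfl⟩

/-! ### Corollary 4.12 (i): the functor `†ℋ𝒯^{𝒟-ΘNF} ↦ †𝒟_> ↦ †𝒟_>^⊢` and the `𝒟`-ΘNF-link -/

/-- Cor. 4.12 (i), the functor on isomorphisms: whatever isomorphism `†𝒟_> ⥲ ‡𝒟_>` an isomorphism of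
`𝒟`-ΘNF-Hodge theaters induces on codomains (Def. 4.6 (ii): "the full poly-isomorphism"), its
mono-analyticisation is a member of the `𝒟`-ΘNF-link `†𝒟_>^⊢ ⥲ ‡𝒟_>^⊢`. [claim: Mochizuki2012, status: disputed] -/
theorem monoIso_mem_dThetaNFLink (H H' : 𝔡.DThetaNFHodgeTheater) (γ : H.cod ≅ H'.cod) :
    DPrimeStrip.monoIso γ ∈ DThetaNFLink 𝔡 H H' :=
  Set.mem_univ _

/-- The `𝒟`-ΘNF-link is symmetric: the inverse of `† ⟶^𝒟 ‡` is `‡ ⟶^𝒟 †`. [claim: Mochizuki2012, status: disputed] -/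
theorem dThetaNFLink_symm (H H' : 𝔡.DThetaNFHodgeTheater) :
    (DThetaNFLink 𝔡 H H').symm = DThetaNFLink 𝔡 H' H :=
  PolyIso.symm_full

/-- `𝒟`-ΘNF-links compose to `𝒟`-ΘNF-links (full ∘ full = full). [claim: Mochizuki2012, status: disputed] -/
theorem dThetaNFLink_comp (H H' H'' : 𝔡.DThetaNFHodgeTheater) :
    (DThetaNFLink 𝔡 H H').comp (DThetaNFLink 𝔡 H' H'') = DThetaNFLink 𝔡 H H'' :=
  PolyIso.comp_full_of_nonempty (dThetaNFLink_nonempty H H')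

/-! ### Corollary 4.12 (ii): the mono-analytic core is a constant invariant of the chain -/

/-- Cor. 4.12 (ii): composing two consecutive links `ⁿ𝒟_>^⊢ ⥲ ⁿ⁺¹𝒟_>^⊢ ⥲ ⁿ⁺²𝒟_>^⊢` of the chain gives THE full
poly-isomorphism `ⁿ𝒟_>^⊢ ⥲ ⁿ⁺²𝒟_>^⊢` — "the output data of the functor of (i) forms a constant invariant".
[claim: Mochizuki2012, status: disputed] -/
theorem DThetaNFChain.link_comp_link (C : DThetaNFChain 𝔡) (n : ℤ) :
    (C.link n).comp (C.link (n + 1)) = DThetaNFLink 𝔡 (C.HT n) (C.HT (n + 1 + 1)) :=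
  dThetaNFLink_comp _ _ _

/-- Cor. 4.12 (ii), path-independence: a link followed by the identification `ⁿ⁺¹𝒟_>^⊢ ⥲ ᵐ𝒟_>^⊢` is the
identification `ⁿ𝒟_>^⊢ ⥲ ᵐ𝒟_>^⊢`, for every `m ∈ ℤ`. [claim: Mochizuki2012, status: disputed] -/
theorem DThetaNFChain.link_comp_dThetaNFLink (C : DThetaNFChain 𝔡) (n m : ℤ) :
    (C.link n).comp (DThetaNFLink 𝔡 (C.HT (n + 1)) (C.HT m)) = DThetaNFLink 𝔡 (C.HT n) (C.HT m) :=
  dThetaNFLink_comp _ _ _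

/-- Cor. 4.12 (ii): going back along a link is again the full poly-isomorphism. [claim: Mochizuki2012, status: disputed] -/
theorem DThetaNFChain.link_symm (C : DThetaNFChain 𝔡) (n : ℤ) :
    (C.link n).symm = DThetaNFLink 𝔡 (C.HT (n + 1)) (C.HT n) :=
  dThetaNFLink_symm _ _

/-- Cor. 4.12 (ii)/(iii): moving along a link of the Frobenius-picture-like chain and then attaching to the
core equals attaching directly — the core is a mono-analytic CORE (constant invariant) of the chain.
[claim: Mochizuki2012, status: disputed] -/
theorem DThetaNFChain.link_comp_attach (C : DThetaNFChain 𝔡) (n : ℤ) :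
    (C.link n).comp (C.etalePicture.attach (n + 1)) = C.etalePicture.attach n :=
  dThetaNFLink_comp _ _ _

/-! ### Corollary 4.12 (iii): the permutation symmetries of the spokes form a transitive `𝔖(ℤ)`-action -/

/-- Relabelling by the identity permutation does nothing. [claim: Mochizuki2012, status: disputed] -/
theorem DEtalePicture.perm_one (E : DEtalePicture 𝔡) : E.perm 1 = E := rfl

/-- Relabellings compose: `𝔖(ℤ)` ACTS on étale-pictures. [claim: Mochizuki2012, status: disputed] -/
theorem DEtalePicture.perm_mul (E : DEtalePicture 𝔡) (σ τ : Equiv.Perm ℤ) :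
    E.perm (σ * τ) = (E.perm σ).perm τ := rfl

/-- The symmetries are TRANSITIVE on spokes: any spoke can be moved to any position (contrast the
Frobenius-picture, where `n` and `n+1` are distinguished by the direction of the link).
[claim: Mochizuki2012, status: disputed] -/
theorem DEtalePicture.exists_perm_spoke_eq (E : DEtalePicture 𝔡) (n m : ℤ) :
    ∃ σ : Equiv.Perm ℤ, (E.perm σ).spoke m = E.spoke n :=
  ⟨Equiv.swap m n, by change E.spoke (Equiv.swap m n m) = E.spoke n; rw [Equiv.swap_apply_left]⟩

/-- The translation `n ↦ n + 1` of the chain (the symmetry the Frobenius-picture LACKS at the level of links) is,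
in the étale-picture, just one of the permutation symmetries: it relabels spoke `n` as `ⁿ⁺¹ℋ𝒯^{𝒟-ΘNF}` and keeps
the core. [claim: Mochizuki2012, status: disputed] -/
theorem DThetaNFChain.etalePicture_perm_addRight (C : DThetaNFChain 𝔡) (n : ℤ) :
    (C.etalePicture.perm (Equiv.addRight 1)).spoke n = C.HT (n + 1) ∧
      (C.etalePicture.perm (Equiv.addRight 1)).core = (C.HT 0).monoCod :=
  ⟨rfl, rfl⟩

end BaseThetaDatum

end Literature.IUT.HodgeTheaters
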